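import Summits.QuantumFields.YangMills.Theorems.BalabanUVNodesN19AtSpineCarriers
import Summits.QuantumFields.YangMills.Theorems.BalabanUVNodesN19CoreKnit

/-!
# YM-DAG node N19 (= NE7 proper) — THE BUDGET ROAD: the node's third conjunct `Σ_K δ_K < ∞` REDUCED to «weights summable (N20 ∕ N21 BY NAME) +
# the margin window», the DECL target at the EXPLICIT budget remainder with the core matching DISPLAYED, the kernel guards (the window is
# necessary; `Summable δ` is load-bearing), and the CHOICE-FREE budget pin at the spine carriers

Cell `pub-ymgap`, HUMAN RULING D-0062 (Track A), R141 (C) wider-strategy seat `pub-ymgap-dag-n19-e` (strategy s3 = ALTERNATIVE CURRENCY;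
dag-lead FAN-OUT v1.1 §N19 s3 «BUDGET ROAD: Σδ_K < ∞ from the landed NE7b∕NE7c weights at the spine carriers + the per-component ∕ budget ∕
criticality files — matching mod constants REDUCED to «weights summable + margin window» with the core matching displayed; honest relative
closer»).  Route `Summits/QuantumFields/YangMills/Theses/BalabanUVNodes.lean` rev 6, cluster item K3 «SpineGivenEndpointR11»
(stmt-QuantumFields-19676); filed `--supports` that item.  COUNT-NEUTRAL: kernel bookkeeping + elementary real analysis; NOT a discharge claim.

THE NODE AND ITS THIRD CONJUNCT.  N19's DECL target is `Spine.NE7.Target vol l₀ δ′ Z := T4CauchySum.MatchingModConstants vol l₀ δ′ Z ∧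
Summable δ′` (NODE-TABLE row n19; `Spine/NE7/Targets.lean` :56).  On the hybrid road (`T4MatchingAssembly.HybridNE7` ⟶ `.matchingModConstants`)
the remainder is `δ′ = T4HybridMatching.hybridDelta vol δ (W + Wsh)`, `vol·δ′_K = vol·δ_K − log(1 − W_K − Wsh_K)`: a TERM budget `δ` (node U4′)
plus a WEIGHT budget (NE7b's `W`, NE7c's `Wsh`).  Every landed N19 knit delivers `∃ δ, Core … δ ∧ Summable δ` (`N19CoreKnit`, `N19RateEdgeByName`,
`N19MarginByName`, …) and the interim spine-carrier pin `N19AtSpineCarriers.deltaOfRecord` (a choice function) makes `Summable S.δ` TRUE BY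
CONSTRUCTION (referee pin [DAGREFB-G4-PIN-N19-DELTAOFRECORD-JUNK-VALUE], pub-ymgap INBOX l.10444).  THIS FILE is the budget road: the
remainder written as ONE displayed formula in the NAMED budgets, its summability proved from «N20's `summable` field + N21's `summable` field +
the margin window», with `Spine.NE7.Core` AT THAT BUDGET the one displayed hypothesis — NE7 proper, NOT PRINTED, NOT proved.

WHAT IS KERNEL-CHECKED ([bookkeeping] = composition of tree theorems BY NAME; [folklore] = elementary real analysis; 0 `def`, 0 `sorry`).
* §1 REDUCTION.  `summable_hybridDelta_iff`: for `0 < vol`, `0 ≤ δ`, `0 ≤ w < 1`, `Summable (hybridDelta vol δ w) ↔ Summable δ ∧ Summable w`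
  (`T4HybridMatching.le_neg_log_one_sub` ∕ `summable_hybridDelta`) — the node's third conjunct IS «term budget summable ∧ weight budget
  summable», nothing else; `summable_targetRemainder_iff_of_weights`: with N20 (`RelWeightBound … W`) and N21 (`ShellWeightBound … Wsh`) BY NAME
  and U4′'s budget half `W + Wsh < 1` it is `↔ Summable δ` (the weights carry their own `summable` fields).  `summable_budget_of_window` ∕
  `budget_nonneg`: the term-wise budget `δ^bud K = max(Cw,1)·(E₀(K+1)^m + Cr)·Σ_{(j,n): j+n=K} min(aⁿ, θ′^j Λgⁿ) + rO K + s K` —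
  `N19CoreKnit.core_summable_of_termBudget`'s remainder VERBATIM (E-branch in the (2.43)-window size profile, other kinds `rO`, centre deviation
  `s`) — is summable (and `≥ 0`) in the MARGIN WINDOW `0 ≤ E₀`, `0 ≤ Cr`, `0 < a < 1`, `0 < θ′ < 1`, `θ′ ≤ Λg`, `Σ rO < ∞`, `Σ s < ∞`
  (`N19CoreKnit.summable_eBranch_windowSize` BY NAME).  `target_of_core_at_budget` — THE HONEST RELATIVE CLOSER at one carrier family: N20 ∧ N21
  ∧ `W + Wsh < 1` ∧ **`Spine.NE7.Core … δ` DISPLAYED** ∧ `Summable δ` ∧ E1∕E2 ∧ L1-pos ⇒ `Spine.NE7.Target vol l₀ (hybridDelta vol δ (W+Wsh)) Z`,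
  ∃-free and choice-free (`NE7.target_of_hybridNE7 ∘ NE7.hybridNE7_of_core` BY NAME); `target_of_core_at_termwiseBudget` — the same AT
  `δ := δ^bud`, `Summable` PROVED from the window: the third conjunct discharged RELATIVE to the displayed core-at-budget, the remainder of
  N19's DECL target a formula in the named rates and weights.
* §2 THE WINDOW IS NECESSARY [folklore] — kernel guards locating the printed warning [GawedzkiKupiainen1985] (142)–(143) p. 20 «the marginal
  discrepancy does not contract; summability needs smallness at birth» (quoted in the tree's `T4BetaMemory`; `T4MatchingAssembly` header
  WHY-IT-MIGHT-FAIL (4)) INSIDE the budget formula: at `θ′ = 1` (no η-rate at birth) the fresh-scale entry `(j,n) = (K,0)` alone gives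
  `1 ≤ Σ_{j+n=K} min(aⁿ, 1^j Λgⁿ)` (`one_le_sliceSum_of_rate_one`), so the E-branch is NOT summable however small `E₀ + Cr > 0`
  (`not_summable_eBranch_of_rate_one`); at `a = 1` (no irrelevance contraction), `1 ≤ Λg`, the entry `(0,K)` does the same
  (`one_le_sliceSum_of_contraction_one`, `not_summable_eBranch_of_contraction_one`).  Smallness (`g_K³`) is not summability.
* §3 `Summable δ` IS LOAD-BEARING — STEP-WISE MATCHING WITH VANISHING REMAINDERS IS NOT THE TARGET [folklore] (kernel witness of item
  stmt-QuantumFields-19182's kill criterion «if the two-run discrepancy only decays like the marginal coupling (1∕k), Σδ_K diverges»).  The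
  HARMONIC TOY: one term class, no bad class, run-A core `P ≡ 1`, run-B core `Q_K(t) = e^{t∕(K+1)}`, `l₀ = vol = 1`.  `Spine.NE7.Core` HOLDS at
  `δ_K = 1∕(K+1)` with `c_K = 0` (`core_harmonicToy`); EVERY `δ` with `Core` has `1∕(K+1) ≤ δ_K` (`inv_succ_le_of_core_harmonicToy`, sources
  `t = ±1`); hence `¬ ∃ δ, Core … δ ∧ Summable δ` (`not_exists_summable_core_harmonicToy`) — the ∃δ-EDGE FAILS while every step matches modulo
  constants with `δ_K → 0`.  At the level of partition functions: `Z_K(t) = exp(t·Σ_{k<K} 1∕(k+1))` satisfies `MatchingModConstants 1 1 (K ↦ 1∕(K+1)) Z`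
  (`matchingModConstants_harmonicToy`), but `genFun Z K 1 = H_K → ∞` is NOT Cauchy (`not_cauchySeq_genFun_harmonicToy`), so NO `(vol, δ′)`
  whatsoever gives `Spine.NE7.Target vol 1 δ′ Z` (`not_exists_target_harmonicToy`, by `T4CauchySum.cauchySeq_genFun`).  Contrast the converse
  phenomenon `T4ApexVariance.exists_tendsto_not_summable_increments` (convergence without summable increments).
* §4 AT THE SPINE CARRIERS — THE BUDGET PIN [bookkeeping], the CHOICE-FREE alternative to the interim `deltaOfRecord` pin (reading for the
  `SRec` author; NODE 00's rate-record home is not in the tree): `summable_delta_of_budgetPin` — a carrier predicate handing, with every bundle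
  it pins, window letters with `S.δ = δ^bud` gives `Summable S.δ` (U4′'s δ-half WITH the window as its content: numeric side conditions on the
  NAMED rates — `a = L^{−β}` of [III] (2.43), `θ′` the common η-rate above N16∕N17∕N18∕N22's, `Λg` the (0.26) multiplicity base; NOT by
  construction); `s_N19_of_budgetPinReading` — if moreover `0 ≤ S.vol`, run A's shell-free cores are `≥ 0` on the good classes, and
  `SRec ∧ Inputs` hand `Spine.NE7.Core` at SOME remainder DOMINATED by `δ^bud` (the term-wise road's own output shape, `N19CoreKnit` §1), then
  `YMDAG.UVSplit.S_N19 SRec Inputs` (`N19AtSpineCarriers.s_N19_of_dominatedEdge` BY NAME: `Core` is monotone in the remainder).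

HONEST FRAMING.  NE7 ∕ NE7b ∕ NE7c are NOT PRINTED ([Balaban1987RG1]–[Balaban1989LargeFieldII] bound ONE run uniformly in `ε`; printed template
[King1986] (3.10)–(3.13) pp. 656–657, context only) and NOT PROVED; `Spine.NE7.Core` at the budget is a HYPOTHESIS wherever it occurs (§1 ∕ §4);
§2–§3 are arithmetic ∕ toy witnesses over `Unit`-indexed families (no Bałaban object); `SRec` ∕ `Inputs` are PARAMETERS; nothing of Bałaban's is
asserted or instantiated; N19 is NOT discharged; Track A count unmoved (5∕27).  One finite four-torus at fixed ε, rung (B)+1 — NOT infinite volume,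
NOT OS on ℝ⁴, NOT a mass gap, NOT Clay.  THEOREMS ONLY; 0 sorry; standard axioms.  No decl carries a cite tag.
-/

set_option autoImplicit false

noncomputable section

open Finset Filter Topology
open scoped BigOperators

namespace Summit.QuantumFields.YangMills.BalabanUVNodes.N19BudgetRoad

open Literature.MathematicalPhysics.QuantumFieldTheory.Balaban1983to89
open T4CauchySum (MatchingModConstants genFun cauchySeq_genFun)
open T4HybridMatching (hybridDelta summable_hybridDelta le_neg_log_one_sub neg_log_one_sub_nonneg)
open T4WeightBudget (RelWeightBound)
open T4IndicatorShell (ShellWeightBound)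
open Summit.QuantumFields.BalabanUV.T4Continuum.Spine
open Summit.QuantumFields.YangMills.BalabanUVNodes.N19CoreKnit (summable_eBranch_windowSize)
open Summit.QuantumFields.YangMills.BalabanUVNodes.N19AtSpineCarriers (core_mono_delta s_N19_of_dominatedEdge)
open YMDAG.UVSplit (SpineCarriers SpineRecordPred InputsPred S_N19)

/-! ## §1 REDUCTION: the third conjunct = «term budget summable ∧ weight budget summable»; the relative closer at the budget -/

section Reduction

variable {vol : ℝ} {δ w : ℕ → ℝ}

/-- **THE NODE'S THIRD CONJUNCT ON THE HYBRID ROAD IS EXACTLY TWO BUDGETS** [folklore].  For `0 < vol`, a nonnegative term remainder `δ`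
and a weight slot `0 ≤ w K < 1`: `Σ_K hybridDelta vol δ w K < ∞ ⟺ Σ_K δ_K < ∞ ∧ Σ_K w_K < ∞`.  (`⇐` is the tree's
`T4HybridMatching.summable_hybridDelta`; `⇒` by `0 ≤ δ_K ≤ δ′_K` and `w_K ≤ −log(1 − w_K) ≤ vol·δ′_K`, `le_neg_log_one_sub`.) [folklore] -/
theorem summable_hybridDelta_iff (hvol : 0 < vol) (hδ : ∀ K, 0 ≤ δ K) (h0 : ∀ K, 0 ≤ w K) (h1 : ∀ K, w K < 1) :
    Summable (hybridDelta vol δ w) ↔ Summable δ ∧ Summable w := by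
  have hlog : ∀ K, 0 ≤ -Real.log (1 - w K) / vol := fun K =>
    div_nonneg (neg_log_one_sub_nonneg (h0 K) (h1 K)) hvol.le
  refine ⟨fun h => ⟨?_, ?_⟩, fun h => summable_hybridDelta h.1 h0 h1 h.2⟩
  · refine Summable.of_nonneg_of_le hδ (fun K => ?_) h
    show δ K ≤ δ K + -Real.log (1 - w K) / vol
    exact le_add_of_nonneg_right (hlog K)
  · have h2 : Summable fun K => -Real.log (1 - w K) / vol := by
      refine Summable.of_nonneg_of_le hlog (fun K => ?_) h
      show -Real.log (1 - w K) / vol ≤ δ K + -Real.log (1 - w K) / vol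
      exact le_add_of_nonneg_left (hδ K)
    have h3 : Summable fun K => -Real.log (1 - w K) := by
      refine (h2.mul_left vol).congr fun K => ?_
      field_simp
    exact Summable.of_nonneg_of_le h0 (fun K => le_neg_log_one_sub (h1 K)) h3

variable {ι : Type*} {l₀ : ℝ} {T : ℕ → Finset ι} {A B shA shB : ℕ → ℝ → ι → ℝ} {Bad : ℕ → ℝ → Finset ι} {W Wsh : ℕ → ℝ}

/-- **WITH THE WEIGHTS BY NAME, THE THIRD CONJUNCT IS «Σ δ_K < ∞»** [bookkeeping].  N20 (`RelWeightBound`, fields `nonneg`, `summable`) and N21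
(`ShellWeightBound`, fields `nonneg`, `summable`) with U4′'s budget half `W + Wsh < 1` and a nonnegative term remainder:
`Summable (hybridDelta vol δ (W + Wsh)) ↔ Summable δ` — the weight budget is carried by the weight structures themselves. [folklore] -/
theorem summable_targetRemainder_iff_of_weights (h20 : RelWeightBound l₀ T A B Bad W) (h21 : ShellWeightBound l₀ T A B shA shB Wsh)
    (hlt : ∀ K, W K + Wsh K < 1) (hvol : 0 < vol) (hδ : ∀ K, 0 ≤ δ K) :
    Summable (hybridDelta vol δ (fun K => W K + Wsh K)) ↔ Summable δ := by
  rw [summable_hybridDelta_iff hvol hδ (fun K => add_nonneg (h20.nonneg K) (h21.nonneg K)) hlt]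
  exact ⟨fun h => h.1, fun h => ⟨h, h20.summable.add h21.summable⟩⟩

end Reduction

section Window

variable {Cw E₀ Cr a θ' Λg : ℝ} {m : ℕ} {rO s : ℕ → ℝ}

/-- **THE TERM-WISE BUDGET IS SUMMABLE IN THE MARGIN WINDOW** [bookkeeping].  The remainder of `N19CoreKnit.core_summable_of_termBudget` —
`δ^bud K = max(Cw,1)·(E₀(K+1)^m + Cr)·Σ_{(j,n): j+n=K} min(aⁿ, θ′^j Λgⁿ) + rO K + s K` — is summable for `0 ≤ E₀`, `0 ≤ Cr`, `0 < a < 1`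
(irrelevance contraction `a = L^{−β}` of (2.43)), `0 < θ′ < 1` (the common η-rate), `θ′ ≤ Λg` (multiplicity base), `Σ rO < ∞`, `Σ s < ∞`
(`N19CoreKnit.summable_eBranch_windowSize` BY NAME: comparison with `(K+1)^{m+1} q^K`, `q < 1` the crossover rate). [folklore] -/
theorem summable_budget_of_window (hE₀ : 0 ≤ E₀) (hCr : 0 ≤ Cr) (ha0 : 0 < a) (ha1 : a < 1) (hθ'0 : 0 < θ') (hθ'1 : θ' < 1)
    (hθ'Λ : θ' ≤ Λg) (hrO : Summable rO) (hs : Summable s) :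
    Summable (fun K : ℕ => (max Cw 1 * ((E₀ * ((K : ℝ) + 1) ^ m + Cr) *
        ∑ x ∈ antidiagonal K, min (a ^ x.2) (θ' ^ x.1 * Λg ^ x.2)) + rO K) + s K) :=
  (((summable_eBranch_windowSize hE₀ hCr ha0 ha1 hθ'0 hθ'1 hθ'Λ).mul_left (max Cw 1)).add hrO).add hs

/-- The term-wise budget is nonnegative (for nonnegative letters). [folklore] -/
theorem budget_nonneg (hE₀ : 0 ≤ E₀) (hCr : 0 ≤ Cr) (ha : 0 ≤ a) (hθ' : 0 ≤ θ') (hΛ : 0 ≤ Λg) (hrO : ∀ K, 0 ≤ rO K)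
    (hs : ∀ K, 0 ≤ s K) (K : ℕ) :
    0 ≤ (max Cw 1 * ((E₀ * ((K : ℝ) + 1) ^ m + Cr) *
        ∑ x ∈ antidiagonal K, min (a ^ x.2) (θ' ^ x.1 * Λg ^ x.2)) + rO K) + s K := by
  have h1 : 0 ≤ ∑ x ∈ antidiagonal K, min (a ^ x.2) (θ' ^ x.1 * Λg ^ x.2) :=
    sum_nonneg fun x _ => le_min (pow_nonneg ha _) (mul_nonneg (pow_nonneg hθ' _) (pow_nonneg hΛ _))
  have h2 : 0 ≤ max Cw 1 := zero_le_one.trans (le_max_right _ _)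
  have h3 : 0 ≤ E₀ * ((K : ℝ) + 1) ^ m + Cr := add_nonneg (mul_nonneg hE₀ (by positivity)) hCr
  exact add_nonneg (add_nonneg (mul_nonneg h2 (mul_nonneg h3 h1)) (hrO K)) (hs K)

end Window

section Closer

variable {ι : Type*} [DecidableEq ι] {l₀ vol : ℝ} {T : ℕ → Finset ι} {A B shA shB : ℕ → ℝ → ι → ℝ}
  {Bad : ℕ → ℝ → Finset ι} {W Wsh δ : ℕ → ℝ} {Z : ℕ → ℝ → ℝ}

/-- **THE HONEST RELATIVE CLOSER AT ONE CARRIER FAMILY** [bookkeeping].  N20 (`RelWeightBound`, NE7b) ∧ N21 (`ShellWeightBound`, NE7c) ∧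
U4′'s budget half `W + Wsh < 1` ∧ **`Spine.NE7.Core` at the remainder `δ` — DISPLAYED, the whole NE7 content** ∧ `Summable δ` ∧ the E1∕E2
dictionary ∧ L1-pos ⇒ N19's DECL target `Spine.NE7.Target vol l₀ δ′ Z` at the EXPLICIT remainder `δ′ = hybridDelta vol δ (W + Wsh)` — no `∃`, no
choice (`NE7.target_of_hybridNE7 ∘ NE7.hybridNE7_of_core` BY NAME).  CONDITIONAL on every binder; NOT NE7. [folklore] -/
theorem target_of_core_at_budget (h20 : RelWeightBound l₀ T A B Bad W) (h21 : ShellWeightBound l₀ T A B shA shB Wsh)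
    (hlt : ∀ K, W K + Wsh K < 1)
    (hcore : NE7.Core l₀ vol T Bad (fun K t τ => A K t τ - shA K t τ) (fun K t τ => B K t τ - shB K t τ) δ)
    (hδ : Summable δ) (hvol : 0 < vol) (hl₀ : 0 ≤ l₀)
    (hZA : ∀ K t, |t| ≤ l₀ → Z K t = ∑ τ ∈ T K, A K t τ) (hZB : ∀ K t, |t| ≤ l₀ → Z (K + 1) t = ∑ τ ∈ T K, B K t τ)
    (hpos : ∀ K t, |t| ≤ l₀ → 0 < ∑ τ ∈ T K, A K t τ) :
    NE7.Target vol l₀ (hybridDelta vol δ (fun K => W K + Wsh K)) Z :=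
  NE7.target_of_hybridNE7 (NE7.hybridNE7_of_core h20 h21 hlt hδ hcore) hvol hl₀ hZA hZB hpos

/-- **THE CLOSER AT THE TERM-WISE BUDGET — THE THIRD CONJUNCT PROVED FROM «WEIGHTS SUMMABLE + MARGIN WINDOW»** [bookkeeping].  As
`target_of_core_at_budget` with `δ := δ^bud` (the remainder of `N19CoreKnit.core_summable_of_termBudget`): the window letters replace the
hypothesis `Summable δ` (`summable_budget_of_window`), so the remainder of N19's DECL target is the FORMULA
`hybridDelta vol δ^bud (W + Wsh)` in the named rates and weights, summable by N20's and N21's own `summable` fields and the window; the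
DISPLAYED hypothesis is `Spine.NE7.Core` at `δ^bud` — matching modulo constants up to the budget (NE7 proper; NOT PRINTED, NOT proved). [folklore] -/
theorem target_of_core_at_termwiseBudget {Cw E₀ Cr a θ' Λg : ℝ} {m : ℕ} {rO s : ℕ → ℝ}
    (h20 : RelWeightBound l₀ T A B Bad W) (h21 : ShellWeightBound l₀ T A B shA shB Wsh) (hlt : ∀ K, W K + Wsh K < 1)
    -- the margin window
    (hE₀ : 0 ≤ E₀) (hCr : 0 ≤ Cr) (ha0 : 0 < a) (ha1 : a < 1) (hθ'0 : 0 < θ') (hθ'1 : θ' < 1) (hθ'Λ : θ' ≤ Λg)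
    (hrO : Summable rO) (hs : Summable s)
    -- the core matching AT THE BUDGET, displayed
    (hcore : NE7.Core l₀ vol T Bad (fun K t τ => A K t τ - shA K t τ) (fun K t τ => B K t τ - shB K t τ)
      (fun K => (max Cw 1 * ((E₀ * ((K : ℝ) + 1) ^ m + Cr) *
        ∑ x ∈ antidiagonal K, min (a ^ x.2) (θ' ^ x.1 * Λg ^ x.2)) + rO K) + s K))
    (hvol : 0 < vol) (hl₀ : 0 ≤ l₀)
    (hZA : ∀ K t, |t| ≤ l₀ → Z K t = ∑ τ ∈ T K, A K t τ) (hZB : ∀ K t, |t| ≤ l₀ → Z (K + 1) t = ∑ τ ∈ T K, B K t τ)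
    (hpos : ∀ K t, |t| ≤ l₀ → 0 < ∑ τ ∈ T K, A K t τ) :
    NE7.Target vol l₀ (hybridDelta vol
      (fun K => (max Cw 1 * ((E₀ * ((K : ℝ) + 1) ^ m + Cr) *
        ∑ x ∈ antidiagonal K, min (a ^ x.2) (θ' ^ x.1 * Λg ^ x.2)) + rO K) + s K)
      (fun K => W K + Wsh K)) Z :=
  target_of_core_at_budget h20 h21 hlt hcore (summable_budget_of_window hE₀ hCr ha0 ha1 hθ'0 hθ'1 hθ'Λ hrO hs) hvol hl₀ hZA
    hZB hpos

end Closer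

/-! ## §2 THE WINDOW IS NECESSARY: no η-rate at birth (`θ′ = 1`) or no irrelevance contraction (`a = 1`) ⇒ the budget diverges -/

section Guards

variable {E₀ Cr a θ' Λg : ℝ} {m : ℕ}

/-- At `θ′ = 1` the fresh-scale entry `(j,n) = (K,0)` of the crossover sum is `min(a⁰, 1^K·Λg⁰) = 1`: `1 ≤ Σ_{j+n=K} min(aⁿ, 1^j Λgⁿ)` for
every `K`. [folklore] -/
theorem one_le_sliceSum_of_rate_one (ha : 0 ≤ a) (hΛ : 0 ≤ Λg) (K : ℕ) :
    1 ≤ ∑ x ∈ antidiagonal K, min (a ^ x.2) ((1 : ℝ) ^ x.1 * Λg ^ x.2) := by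
  have hmem : (K, 0) ∈ antidiagonal K := by simp
  have h := single_le_sum (s := antidiagonal K) (f := fun x : ℕ × ℕ => min (a ^ x.2) ((1 : ℝ) ^ x.1 * Λg ^ x.2))
    (fun x _ => le_min (pow_nonneg ha _) (mul_nonneg (pow_nonneg zero_le_one _) (pow_nonneg hΛ _))) hmem
  simpa using h

/-- **NO η-RATE AT BIRTH ⇒ THE E-BRANCH OF THE BUDGET IS NOT SUMMABLE**, however small its constants: at `θ′ = 1`, `0 < E₀ + Cr`, the
sequence `K ↦ (E₀(K+1)^m + Cr)·Σ_{j+n=K} min(aⁿ, 1^j Λgⁿ)` is bounded below by `E₀ + Cr` and does not tend to `0`.  This is where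
[GawedzkiKupiainen1985] (142)–(143)'s warning sits in the budget formula: the discrepancy injected at the last scale is not contracted by
anything but its own rate `θ′^K`. [folklore] -/
theorem not_summable_eBranch_of_rate_one (hE₀ : 0 ≤ E₀) (hpos : 0 < E₀ + Cr) (ha : 0 ≤ a) (hΛ : 0 ≤ Λg) :
    ¬ Summable (fun K : ℕ => (E₀ * ((K : ℝ) + 1) ^ m + Cr) *
        ∑ x ∈ antidiagonal K, min (a ^ x.2) ((1 : ℝ) ^ x.1 * Λg ^ x.2)) := by
  intro h
  have hlow : ∀ K : ℕ, E₀ + Cr ≤ (E₀ * ((K : ℝ) + 1) ^ m + Cr) *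
      ∑ x ∈ antidiagonal K, min (a ^ x.2) ((1 : ℝ) ^ x.1 * Λg ^ x.2) := fun K => by
    have h1 := one_le_sliceSum_of_rate_one ha hΛ K
    have h1m : (1 : ℝ) ≤ ((K : ℝ) + 1) ^ m := one_le_pow₀ (by linarith [(Nat.cast_nonneg K : (0 : ℝ) ≤ K)])
    have h2 : E₀ + Cr ≤ E₀ * ((K : ℝ) + 1) ^ m + Cr := by nlinarith
    calc E₀ + Cr = (E₀ + Cr) * 1 := (mul_one _).symm
      _ ≤ (E₀ * ((K : ℝ) + 1) ^ m + Cr) * ∑ x ∈ antidiagonal K, min (a ^ x.2) ((1 : ℝ) ^ x.1 * Λg ^ x.2) :=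
        mul_le_mul h2 h1 zero_le_one (hpos.le.trans h2)
  linarith [ge_of_tendsto' h.tendsto_atTop_zero hlow]

/-- At `a = 1`, `1 ≤ Λg`, the oldest-scale entry `(j,n) = (0,K)` of the crossover sum is `min(1^K, θ′⁰·Λg^K) = 1`:
`1 ≤ Σ_{j+n=K} min(1ⁿ, θ′^j Λgⁿ)` for every `K`. [folklore] -/
theorem one_le_sliceSum_of_contraction_one (hθ' : 0 ≤ θ') (hΛ : 1 ≤ Λg) (K : ℕ) :
    1 ≤ ∑ x ∈ antidiagonal K, min ((1 : ℝ) ^ x.2) (θ' ^ x.1 * Λg ^ x.2) := by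
  have hmem : (0, K) ∈ antidiagonal K := by simp
  have h := single_le_sum (s := antidiagonal K) (f := fun x : ℕ × ℕ => min ((1 : ℝ) ^ x.2) (θ' ^ x.1 * Λg ^ x.2))
    (fun x _ => le_min (pow_nonneg zero_le_one _) (mul_nonneg (pow_nonneg hθ' _) (pow_nonneg (zero_le_one.trans hΛ) _)))
    hmem
  have h2 : (1 : ℝ) ≤ min ((1 : ℝ) ^ ((0, K) : ℕ × ℕ).2) (θ' ^ ((0, K) : ℕ × ℕ).1 * Λg ^ ((0, K) : ℕ × ℕ).2) := by
    dsimp only; rw [one_pow, pow_zero, one_mul]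
    exact le_min le_rfl (one_le_pow₀ hΛ)
  exact h2.trans h

/-- **NO IRRELEVANCE CONTRACTION ⇒ THE E-BRANCH IS NOT SUMMABLE**: at `a = 1` (`β = 0` in (2.43)), `1 ≤ Λg`, `0 < E₀ + Cr`, the sequence
`K ↦ (E₀(K+1)^m + Cr)·Σ_{j+n=K} min(1ⁿ, θ′^j Λgⁿ)` is bounded below by `E₀ + Cr`: the discrepancy injected at the first scale is never
transported away. [folklore] -/
theorem not_summable_eBranch_of_contraction_one (hE₀ : 0 ≤ E₀) (hpos : 0 < E₀ + Cr) (hθ' : 0 ≤ θ') (hΛ : 1 ≤ Λg) :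
    ¬ Summable (fun K : ℕ => (E₀ * ((K : ℝ) + 1) ^ m + Cr) *
        ∑ x ∈ antidiagonal K, min ((1 : ℝ) ^ x.2) (θ' ^ x.1 * Λg ^ x.2)) := by
  intro h
  have hlow : ∀ K : ℕ, E₀ + Cr ≤ (E₀ * ((K : ℝ) + 1) ^ m + Cr) *
      ∑ x ∈ antidiagonal K, min ((1 : ℝ) ^ x.2) (θ' ^ x.1 * Λg ^ x.2) := fun K => by
    have h1 := one_le_sliceSum_of_contraction_one hθ' hΛ K
    have h1m : (1 : ℝ) ≤ ((K : ℝ) + 1) ^ m := one_le_pow₀ (by linarith [(Nat.cast_nonneg K : (0 : ℝ) ≤ K)])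
    have h2 : E₀ + Cr ≤ E₀ * ((K : ℝ) + 1) ^ m + Cr := by nlinarith
    calc E₀ + Cr = (E₀ + Cr) * 1 := (mul_one _).symm
      _ ≤ (E₀ * ((K : ℝ) + 1) ^ m + Cr) * ∑ x ∈ antidiagonal K, min ((1 : ℝ) ^ x.2) (θ' ^ x.1 * Λg ^ x.2) :=
        mul_le_mul h2 h1 zero_le_one (hpos.le.trans h2)
  linarith [ge_of_tendsto' h.tendsto_atTop_zero hlow]

end Guards

/-! ## §3 `Summable δ` IS LOAD-BEARING: the harmonic toy — step-wise matching with `δ_K = 1∕(K+1) → 0`, no summable remainder, no target -/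

section HarmonicToy

/-- **THE HARMONIC TOY HAS `Core` AT `δ_K = 1∕(K+1)`** [folklore]: one class (`Unit`), no bad class, run-A core `P ≡ 1`, run-B core
`Q_K(t) = e^{t∕(K+1)}`, `l₀ = vol = 1`; the constant is `c_K = 0` and `|t∕(K+1)| ≤ 1∕(K+1)` on `|t| ≤ 1`.  Each step matches modulo constants
with a remainder tending to `0`. [folklore] -/
theorem core_harmonicToy :
    NE7.Core (1 : ℝ) 1 (fun _ => (Finset.univ : Finset Unit)) (fun _ _ => ∅) (fun _ _ _ => (1 : ℝ))
      (fun K t _ => Real.exp (t / ((K : ℝ) + 1))) (fun K => 1 / ((K : ℝ) + 1)) := by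
  intro K
  refine ⟨0, fun t ht τ _ => ?_⟩
  have hK : (0 : ℝ) < (K : ℝ) + 1 := by positivity
  obtain ⟨ht1, ht2⟩ := abs_le.mp ht
  have hlo : -(1 / ((K : ℝ) + 1)) ≤ t / ((K : ℝ) + 1) := by
    rw [← neg_div]; exact div_le_div_of_nonneg_right ht1 hK.le
  have hhi : t / ((K : ℝ) + 1) ≤ 1 / ((K : ℝ) + 1) := div_le_div_of_nonneg_right ht2 hK.le
  rw [mul_one, mul_one, zero_sub, zero_add, one_mul]
  exact ⟨Real.exp_le_exp.mpr hlo, Real.exp_le_exp.mpr hhi⟩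

/-- **EVERY REMAINDER CARRYING `Core` FOR THE HARMONIC TOY IS AT LEAST HARMONIC** [folklore]: if `Core 1 1 … P Q δ` with the toy's cores,
then `1∕(K+1) ≤ δ_K` for all `K` (evaluate the sandwich at the sources `t = 1` and `t = −1`: `1∕(K+1) ≤ c_K + δ_K` and
`c_K − δ_K ≤ −1∕(K+1)`). [folklore] -/
theorem inv_succ_le_of_core_harmonicToy (δ : ℕ → ℝ)
    (h : NE7.Core (1 : ℝ) 1 (fun _ => (Finset.univ : Finset Unit)) (fun _ _ => ∅) (fun _ _ _ => (1 : ℝ))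
      (fun K t _ => Real.exp (t / ((K : ℝ) + 1))) δ) (K : ℕ) :
    1 / ((K : ℝ) + 1) ≤ δ K := by
  obtain ⟨c, hc⟩ := h K
  have hmem : (() : Unit) ∈ (Finset.univ : Finset Unit) \ (∅ : Finset Unit) := by simp
  have h1 := (hc 1 (by simp) () hmem).2
  have h2 := (hc (-1) (by simp) () hmem).1
  rw [mul_one, one_mul] at h1 h2
  have h1' := Real.exp_le_exp.mp h1
  have h2' := Real.exp_le_exp.mp h2
  rw [neg_div] at h2'; linarith

/-- **THE ∃δ-EDGE FAILS FOR THE HARMONIC TOY** [folklore]: there is NO summable `δ` with `Core` — although every step matches modulo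
constants with `δ_K = 1∕(K+1) → 0` (`core_harmonicToy`).  `Summable δ` is where a `(1∕k)`-decaying two-run discrepancy dies (item
stmt-QuantumFields-19182's kill criterion, in kernel form; `Real.not_summable_one_div_natCast`). [folklore] -/
theorem not_exists_summable_core_harmonicToy :
    ¬ ∃ δ : ℕ → ℝ, NE7.Core (1 : ℝ) 1 (fun _ => (Finset.univ : Finset Unit)) (fun _ _ => ∅) (fun _ _ _ => (1 : ℝ))
      (fun K t _ => Real.exp (t / ((K : ℝ) + 1))) δ ∧ Summable δ := by
  rintro ⟨δ, hc, hs⟩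
  have h1 : Summable (fun K : ℕ => 1 / ((K : ℝ) + 1)) :=
    Summable.of_nonneg_of_le (fun K => by positivity) (inv_succ_le_of_core_harmonicToy δ hc) hs
  have h2 : Summable (fun K : ℕ => 1 / ((K + 1 : ℕ) : ℝ)) := h1.congr fun K => by push_cast; rfl
  exact Real.not_summable_one_div_natCast ((summable_nat_add_iff 1).mp h2)

/-- **THE TOY'S PARTITION FUNCTIONS MATCH MODULO CONSTANTS AT EVERY STEP** [folklore]: `Z_K(t) = exp(t·Σ_{k<K} 1∕(k+1))` (so
`Z_{K+1}(t)∕Z_K(t) = e^{t∕(K+1)}`, the toy's core ratio) satisfies `T4CauchySum.MatchingModConstants 1 1 (K ↦ 1∕(K+1)) Z` with `c_K = 0`. [folklore] -/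
theorem matchingModConstants_harmonicToy :
    MatchingModConstants 1 1 (fun K => 1 / ((K : ℝ) + 1))
      (fun K t => Real.exp (t * ∑ k ∈ range K, 1 / ((k : ℝ) + 1))) := by
  intro K
  refine ⟨0, fun t ht => ?_⟩
  have hK : (0 : ℝ) < (K : ℝ) + 1 := by positivity
  rw [Real.log_exp, Real.log_exp, sum_range_succ, sub_zero, one_mul]
  have e : t * (∑ k ∈ range K, 1 / ((k : ℝ) + 1) + 1 / ((K : ℝ) + 1)) - t * ∑ k ∈ range K, 1 / ((k : ℝ) + 1)
      = t / ((K : ℝ) + 1) := by ring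
  rw [e, abs_div, abs_of_pos hK]
  exact div_le_div_of_nonneg_right ht hK.le

/-- **… BUT ITS GENERATING FUNCTIONS ARE NOT CAUCHY** [folklore]: `genFun Z K 1 = Σ_{k<K} 1∕(k+1) = H_K → ∞`
(`Real.tendsto_sum_range_one_div_nat_succ_atTop`), so `K ↦ genFun Z K 1` is not a Cauchy sequence — node U6's conclusion FAILS for a family
matching modulo constants at every step with vanishing remainders. [folklore] -/
theorem not_cauchySeq_genFun_harmonicToy :
    ¬ CauchySeq (fun K => genFun (fun K t => Real.exp (t * ∑ k ∈ range K, 1 / ((k : ℝ) + 1))) K 1) := by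
  have hgen : (fun K => genFun (fun K t => Real.exp (t * ∑ k ∈ range K, 1 / ((k : ℝ) + 1))) K 1)
      = fun K => ∑ k ∈ range K, 1 / ((k : ℝ) + 1) := by
    funext K; simp only [genFun, Real.log_exp, one_mul, zero_mul, sub_zero]
  rw [hgen]; intro h
  obtain ⟨x, hx⟩ := cauchySeq_tendsto_of_complete h
  exact not_tendsto_nhds_of_tendsto_atTop Real.tendsto_sum_range_one_div_nat_succ_atTop x hx

/-- **NO TARGET AT ALL FOR THE HARMONIC TOY** [folklore]: for NO volume letter `vol` and NO remainder sequence `δ′` does N19's DECL target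
`Spine.NE7.Target vol 1 δ′ Z` hold for the toy's partition functions — `Target` gives Cauchy generating functions on `|t| ≤ 1`
(`T4CauchySum.cauchySeq_genFun`), contradicting `not_cauchySeq_genFun_harmonicToy`.  So `MatchingModConstants` with `δ_K → 0`
(`matchingModConstants_harmonicToy`) is strictly weaker than the target: the conjunct `Summable δ′` cannot be dropped or weakened to decay. [folklore] -/
theorem not_exists_target_harmonicToy :
    ¬ ∃ (vol : ℝ) (δ' : ℕ → ℝ), NE7.Target vol 1 δ' (fun K t => Real.exp (t * ∑ k ∈ range K, 1 / ((k : ℝ) + 1))) := by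
  rintro ⟨vol, δ', hM, hδ'⟩
  exact not_cauchySeq_genFun_harmonicToy (cauchySeq_genFun hM zero_le_one hδ' (t := 1) (by simp))

end HarmonicToy

/-! ## §4 AT THE SPINE CARRIERS: the CHOICE-FREE budget pin — U4′'s δ-half from the window, `S_N19` from a dominated core edge -/

section SpinePin

variable {N : ℕ} [NeZero N]

/-- **U4′'s δ-HALF UNDER THE BUDGET PIN — WITH CONTENT (the window), NOT BY CONSTRUCTION** [bookkeeping].  If the carrier predicate `SRec`
hands, with every bundle `S` it pins, window letters `Cw E₀ Cr a θ′ Λg m rO s` — `0 ≤ E₀`, `0 ≤ Cr`, `0 < a < 1`, `0 < θ′ < 1`, `θ′ ≤ Λg`,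
`Σ rO < ∞`, `Σ s < ∞` — with the remainder slot PINNED TO THE BUDGET, `S.δ = δ^bud`, then `Summable S.δ` (`summable_budget_of_window`).
Contrast `N19AtSpineCarriers.summable_delta_of_pin` (choice pin: true by construction): here the content is the window — numeric side
conditions on NAMED rates (`a = L^{−β}` of (2.43); `θ′` above N16∕N17∕N18∕N22's rates; `Λg` the (0.26) base). [folklore] -/
theorem summable_delta_of_budgetPin (SRec : SpineRecordPred N)
    (hpin : ∀ (F : T4Continuum.T4Family) (D : YMDAG.UVSplit.Datum F N) (g₀ : ℕ → ℝ) (os : List (T4Continuum.ULoop F))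
      (S : SpineCarriers), SRec F D g₀ os S →
      ∃ (Cw E₀ Cr a θ' Λg : ℝ) (m : ℕ) (rO s : ℕ → ℝ),
        0 ≤ E₀ ∧ 0 ≤ Cr ∧ 0 < a ∧ a < 1 ∧ 0 < θ' ∧ θ' < 1 ∧ θ' ≤ Λg ∧ Summable rO ∧ Summable s ∧
        S.δ = fun K : ℕ => (max Cw 1 * ((E₀ * ((K : ℝ) + 1) ^ m + Cr) *
          ∑ x ∈ antidiagonal K, min (a ^ x.2) (θ' ^ x.1 * Λg ^ x.2)) + rO K) + s K)
    (F : T4Continuum.T4Family) (D : YMDAG.UVSplit.Datum F N) (g₀ : ℕ → ℝ) (os : List (T4Continuum.ULoop F))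
    (S : SpineCarriers) (hS : SRec F D g₀ os S) : Summable S.δ := by
  obtain ⟨Cw, E₀, Cr, a, θ', Λg, m, rO, s, hE₀, hCr, ha0, ha1, hθ'0, hθ'1, hθ'Λ, hrO, hs, hδ⟩ := hpin F D g₀ os S hS
  rw [hδ]; exact summable_budget_of_window hE₀ hCr ha0 ha1 hθ'0 hθ'1 hθ'Λ hrO hs

/-- **`S_N19` FOR EVERY BUDGET-PIN READING WITH A DOMINATED CORE EDGE** [bookkeeping].  If `SRec` pins the remainder slot to the budget
(`S.δ = δ^bud` for window letters read off the bundle), keeps `0 ≤ S.vol` and run A's shell-free cores nonnegative on the good classes, and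
the pair `SRec ∧ Inputs` hands `Spine.NE7.Core` at SOME remainder `δ` DOMINATED by the budget (`δ K ≤ δ^bud K` — the output shape of the
term-wise road, `N19CoreKnit.core_summable_of_termBudget`, whose remainder IS `δ^bud`), then `YMDAG.UVSplit.S_N19 SRec Inputs`
(`N19AtSpineCarriers.s_N19_of_dominatedEdge` BY NAME — `Core` is monotone in the remainder on nonnegative cores).  The displayed core edge is
the WHOLE N19 content; CHOICE-FREE. [folklore] -/
theorem s_N19_of_budgetPinReading (SRec : SpineRecordPred N) (Inputs : InputsPred N)
    (hpos : ∀ (F : T4Continuum.T4Family) (D : YMDAG.UVSplit.Datum F N) (g₀ : ℕ → ℝ) (os : List (T4Continuum.ULoop F))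
      (S : SpineCarriers), SRec F D g₀ os S → letI := S.dec
      0 ≤ S.vol ∧ ∀ K t, |t| ≤ S.l₀ → ∀ τ ∈ S.T K \ S.Bad K t, 0 ≤ S.A K t τ - S.shA K t τ)
    (hread : ∀ (F : T4Continuum.T4Family) (D : YMDAG.UVSplit.Datum F N) (g₀ : ℕ → ℝ) (os : List (T4Continuum.ULoop F))
      (S : SpineCarriers), SRec F D g₀ os S → Inputs F D g₀ os → letI := S.dec
      ∃ (Cw E₀ Cr a θ' Λg : ℝ) (m : ℕ) (rO s δ : ℕ → ℝ),
        (S.δ = fun K : ℕ => (max Cw 1 * ((E₀ * ((K : ℝ) + 1) ^ m + Cr) *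
          ∑ x ∈ antidiagonal K, min (a ^ x.2) (θ' ^ x.1 * Λg ^ x.2)) + rO K) + s K) ∧
        NE7.Core S.l₀ S.vol S.T S.Bad (fun K t τ => S.A K t τ - S.shA K t τ) (fun K t τ => S.B K t τ - S.shB K t τ) δ ∧
        ∀ K, δ K ≤ (max Cw 1 * ((E₀ * ((K : ℝ) + 1) ^ m + Cr) *
          ∑ x ∈ antidiagonal K, min (a ^ x.2) (θ' ^ x.1 * Λg ^ x.2)) + rO K) + s K) :
    S_N19 SRec Inputs := by
  refine s_N19_of_dominatedEdge SRec Inputs hpos fun F D g₀ os S hS hI => ?_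
  letI := S.dec
  obtain ⟨Cw, E₀, Cr, a, θ', Λg, m, rO, s, δ, hpin, hcore, hle⟩ := hread F D g₀ os S hS hI
  exact ⟨δ, hcore, fun K => by rw [hpin]; exact hle K⟩

end SpinePin

end Summit.QuantumFields.YangMills.BalabanUVNodes.N19BudgetRoad

end
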